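import Mathlib
import Summits.RiemannHypothesis.RiemannHypothesis.Theorems.IntegerScrewPrimeRangeProducts
import HarnessLib

/-!
# Route `IntegerScrew` — the harmonic mass of the users of an edge of the smallest-prime tree, smooth and rough
# (edge loads of PROP. K's root flow and of PROP. K″'s hub flow, CONTINUUM-LIMIT §24.11, §27.2)

The flows of PROP. K / K″ are superpositions of smallest-prime paths; the load of the edge below a node `y` is the
harmonic mass of the path users `x` (`y ∣ x`, the quotient `x/y` composed of primes from a prescribed set `s`:
`s = {q ≤ minFac y}` for the tree flow, `s = {Q < q ≤ minFac y}` for the hub legs `α`, `γ` of K″ through the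
`Q`-rough numbers).  One Euler product bounds them all:

* **`sum_inv_factored_path_users_le`** — `Σ_{x ≤ M : y ∣ x, x/y ∈ factoredNumbers s} 1/x ≤ (1/y)·Π_{p∈s prime}(1 − 1/p)⁻¹`;
* (the tree case `x/y (minFac y + 1)-smooth`, `≤ (1/y)·Π_{q ≤ minFac y}(1 − 1/q)⁻¹`, is the tree's
  `IntegerScrewWalkPoincareMertens.sum_inv_path_users_le` and is not restated here);
* **`sum_inv_rough_path_users_le`** — the hub case, primes of `x/y` in `[Q+1, minFac y]`:
  `≤ (1/y)·(1 + e⁵·log(minFac y + 1)/log(Q+1))` for `Q ≥ 1` (`prod_range_inv_le`).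

RH-free, elementary.  Nothing in this file bears on the truth of RH.
References: CONTINUUM-LIMIT §24.11, §27.2 (rh-explicit A6-PIVOT); M. Suzuki, J. Lond. Math. Soc. (2) 108 (2023)
1448–1487 [Suzuki2023] for the screw matrices this serves.
-/

noncomputable section

set_option linter.dupNamespace false -- D-0017: `Summit.<S>.<S>.…` is the designed namespace

namespace Summit.RiemannHypothesis.RiemannHypothesis.Theorems.IntegerScrew

open Finset Real

/-- **The users of the edge below `y` with quotients factored over `s`** weigh at most `(1/y)·Π_{p∈s prime}(1 − 1/p)⁻¹`:
`Σ_{x ≤ M : y ∣ x, x/y ∈ factoredNumbers s} 1/x ≤ (1/y)·Π_{p ∈ s, p prime}(1 − 1/p)⁻¹` (`y ≥ 1`). -/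
theorem sum_inv_factored_path_users_le (s : Finset ℕ) {M y : ℕ} (hy : 1 ≤ y) :
    ∑ x ∈ (Icc 1 M).filter (fun x => y ∣ x ∧ x / y ∈ Nat.factoredNumbers s), (1 : ℝ) / x ≤
      (1 / (y : ℝ)) * ∏ p ∈ s with p.Prime, (1 - 1 / (p : ℝ))⁻¹ := by
  have hy0 : y ≠ 0 := by omega
  have hset : (Icc 1 M).filter (fun x => y ∣ x ∧ x / y ∈ Nat.factoredNumbers s) =
      ((Icc 1 (M / y)).filter (· ∈ Nat.factoredNumbers s)).map ⟨fun m => y * m, mul_right_injective₀ hy0⟩ := by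
    ext x
    simp only [mem_filter, mem_Icc, mem_map, Function.Embedding.coeFn_mk]
    constructor
    · rintro ⟨⟨h1, h2⟩, ⟨m, rfl⟩, hs⟩
      rw [Nat.mul_div_cancel_left _ (by omega)] at hs
      refine ⟨m, ⟨⟨?_, ?_⟩, hs⟩, rfl⟩
      · rcases Nat.eq_zero_or_pos m with h | h
        · subst h; simp at h1
        · exact h
      · exact (Nat.le_div_iff_mul_le hy).2 (by rw [mul_comm]; exact h2)
    · rintro ⟨m, ⟨⟨h1, h2⟩, hs⟩, rfl⟩
      refine ⟨⟨?_, ?_⟩, dvd_mul_right y m, ?_⟩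
      · exact Nat.one_le_iff_ne_zero.2 (Nat.mul_ne_zero hy0 (by omega))
      · have := (Nat.le_div_iff_mul_le hy).1 h2
        rwa [mul_comm] at this
      · rwa [Nat.mul_div_cancel_left _ (by omega)]
  rw [hset, sum_map]
  simp only [Function.Embedding.coeFn_mk]
  have hre : ∑ m ∈ (Icc 1 (M / y)).filter (· ∈ Nat.factoredNumbers s), (1 : ℝ) / ((y * m : ℕ) : ℝ) =
      (1 / (y : ℝ)) * ∑ m ∈ (Icc 1 (M / y)).filter (· ∈ Nat.factoredNumbers s), (1 : ℝ) / m := by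
    rw [Finset.mul_sum]
    refine Finset.sum_congr rfl fun m _ => ?_
    push_cast
    rw [one_div_mul_one_div]
  rw [hre]
  exact mul_le_mul_of_nonneg_left (sum_inv_factored_le_prod s (M / y)) (by positivity)

/-- **The hub case** (legs `α`, `γ` of PROP. K″): for `y ≥ 1` and `Q ≥ 1`,
`Σ_{x ≤ M : y ∣ x, every prime of x/y in [Q+1, minFac y]} 1/x ≤ (1/y)·(1 + e⁵·log(minFac y + 1)/log(Q+1))`. -/
theorem sum_inv_rough_path_users_le {M y Q : ℕ} (hy : 1 ≤ y) (hQ : 1 ≤ Q) :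
    ∑ x ∈ (Icc 1 M).filter (fun x => y ∣ x ∧ x / y ∈ Nat.factoredNumbers (Icc (Q + 1) y.minFac)), (1 : ℝ) / x ≤
      (1 / (y : ℝ)) * (1 + Real.exp 5 * Real.log ((y.minFac : ℝ) + 1) / Real.log ((Q : ℝ) + 1)) := by
  refine (sum_inv_factored_path_users_le (Icc (Q + 1) y.minFac) (M := M) hy).trans ?_
  refine mul_le_mul_of_nonneg_left ?_ (by positivity)
  have h := prod_range_inv_le (q := Q + 1) (X := y.minFac) (by omega)
  push_cast at h
  exact h

end Summit.RiemannHypothesis.RiemannHypothesis.Theorems.IntegerScrew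

end
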